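import Mathlib
import Summits.QuantumFields.YangMills.Theses.FlatTubeReduction
import Summits.QuantumFields.YangMills.Theorems.FlatTubeReductionNearFlatOfBORate

/-!
# SKELETON «borate» for the crux K1 `NearFlatRatioLaw` (stmt-QuantumFields-24720, route `FlatTubeReduction`) — ONE STUB: the Born–Oppenheimer
# data WITH RATE at level one on every lattice of size `L ≥ 2` — VERBATIM the single registered stub `stub_boRate : BORateAll` of the FCL crux
# `FixedLatticeLaw` (stmt-QuantumFields-23943, `Cruxes/FixedLatticeLaw/Lines/rate.lean`, ns `…Cruxes.FixedLatticeLaw.Rate`) — ONE pooled obligation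

Seat `ym-line-ftr-p1` (g4 registered this skeleton 2026-08-28T10:54:47Z, sha b12a25d1cbc0…; g6 republishes it as the crux workfile `Lines/borate.lean`
— the g4/g5 seats had no crux-write key).  LINE 2 of route `FlatTubeReduction` (planner ym-idea-1 g3: K1 split along the vacuum valley) carries NO
analytic debt of its own any more: the dichotomy glue (g3: p617122 `nearFlatRatioLaw_of_pinnedTubeRatioLaw_window`, p619200
`nearFlatRatioLaw_of_nearRegionTubeRatioLaw`), the ground-state concentration and the near-region law from the INNER RATE (g4: p622971, p623489,
p624647, p625205, p625771, p626045 `nearFlatRatioLaw_of_boRate`) reduce K1 to EXACTLY the Born–Oppenheimer data with rate that also closes 23943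
through the FCL door `innerRateAt_of_bo_pow 1` (p599058) and `femtoGapFixedLattice_of_bo` (p599787).  K1a′ `PinnedTubeRatioLawW` (27141) is
EQUIVALENT to K1 modulo landed glue (g6: `nearFlatRatioLaw_iff_pinnedTubeRatioLawW`).
* `stub_boRate : BORateAll` — for every `L ≥ 2`, eventually in `β` (`u = λ_b(L³β)`, `μ_j = levelValue su2Rep 1 (L³β) j`): a normalisation `N > 0`
  with the FLOOR WITH RATE `N μ₀ e^{−Cu²} ≤ λ₀(β,L)`, and for every bounded measurable gauge-invariant pair `G₀, G₁` supported in
  `{orbitDist < β^{−1/40}}` an ADIABATIC SPLIT `φᵢ` and a PHYSICAL ONE-SITE pair `gᵢ` with, for every combination (`χ = ψ − φ`):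
  (P1) `2|⟨φ,χ⟩| ≤ Cu²(‖φ‖² + ‖χ‖²)`; (P3) `⟨χ,K_βχ⟩ ≤ (1 − gap)·Nμ₁·‖χ‖²`; (P4) `⟨φ,K_βχ⟩² ≤ Cu²(Nμ₁)²‖φ‖²‖χ‖²`;
  (P5) `⟨φ,K_βφ⟩ ≤ e^{Cu²}N⟨g,K^{(1)}_{L³β}g⟩ + Cu²·Nμ₁·‖φ‖²`; (P6) `‖g‖² ≤ e^{Cu²}‖φ‖²`.
STATE OF THE POOL (2026-08-28T11:30Z): `stub_boRate` is the RATE twin (tolerance `C·u²`) of route RED lane A's OPEN C4-CORE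
`SoftTubeBOPackageAt L (recordWeight L (powScale s) (powScale 1))` (tolerance `ε·λ_b`; p622264; seat ym-luscher-20007-p1, COARSE-DESIGN §23); design
notes for the rate twin: `Cruxes/FixedLatticeLaw/Lines/rate.md` (APPENDIX v3–v5, RATE POINTS 1–3) and the g5 memo `rate-twin-readiness-g5.md` (evidence
#12 on this item: c-frozen stiff model forced; STIFF/OFF-DIAG bricks transfer with `η = O(β^{-1/2}polylog)`, DIAG needs an odd/even split; (P5)/(P6) for
every profile by w-parity + u↔u′ symmetrisation; no black-box Temple/Kato pooling).
HONEST FRAMING: `stub_boRate` is OPEN fixed-lattice semiclassics on `SU(2)^{3L³}` (XL); femto rung R2b1 (RECORD label) — not infinite volume, not a mass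
gap, not Clay.  No summit is proved by this line.
-/

set_option autoImplicit false

noncomputable section

open MeasureTheory Real
open scoped BigOperators
open Literature.MathematicalPhysics.QuantumFieldTheory hiding SU2
open Literature.MathematicalPhysics.QuantumLattice
open Summit.QuantumFields.YangMills.Theorems.FemtoTransferGap
open Summit.QuantumFields.YangMills.Theorems.FemtoCutoffLadder
open Summit.QuantumFields.YangMills.Theorems.FlatTubeReduction
open Summit.QuantumFields.YangMills.Theses.FlatTubeReduction

namespace Summit.QuantumFields.YangMills.Cruxes.NearFlatRatioLaw.Borate

/-- **BORN–OPPENHEIMER DATA WITH RATE at level one, on every lattice of size `L ≥ 2`** (inner scale `β^{−1/40}`): VERBATIM the body of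
`Summit.QuantumFields.YangMills.Cruxes.FixedLatticeLaw.Rate.BORateAll` (= the hypothesis `hBO` of the landed `femtoGapFixedLattice_of_bo` and of
`FlatTubeReduction.nearFlatRatioLaw_of_boRate`) — floor with rate + adiabatic split (P1)(P3)(P4)(P5)(P6). -/
def BORateAll : Prop :=
  ∀ (L : ℕ) [NeZero L], 2 ≤ L →
      ∃ C gap βB : ℝ, 0 < gap ∧ ∀ β : ℝ, βB ≤ β →
        ∃ N : ℝ, 0 < N ∧
          N * levelValue su2Rep 1 ((L : ℝ) ^ 3 * β) 0 * Real.exp (-(C * bareLambda ((L : ℝ) ^ 3 * β) ^ 2)) ≤ levelValue su2Rep L β 0 ∧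
          ∀ G : Fin 2 → (GaugeConfig 3 L SU2 → ℝ),
            (∀ i, Measurable (G i)) → (∀ i, ∃ C' : ℝ, ∀ U, |G i U| ≤ C') →
            (∀ i (g : Site 3 L → SU2) (U : GaugeConfig 3 L SU2), G i (gaugeTransform g U) = G i U) →
            (∀ i U, G i U ≠ 0 → orbitDist U < powScale (1 / 40) β) →
            ∃ (φ : Fin 2 → (GaugeConfig 3 L SU2 → ℝ)) (g : Fin 2 → (GaugeConfig 3 1 SU2 → ℝ)),
              (∀ i, Measurable (φ i)) ∧ (∀ i, ∃ C' : ℝ, ∀ U, |φ i U| ≤ C') ∧ (∀ i, IsPhys (g i)) ∧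
              ∀ a : Fin 2 → ℝ,
                2 * |l2 (fun U => ∑ i, a i * φ i U) (fun U => ∑ i, a i * G i U - ∑ i, a i * φ i U)| ≤
                    C * bareLambda ((L : ℝ) ^ 3 * β) ^ 2 *
                      (l2 (fun U => ∑ i, a i * φ i U) (fun U => ∑ i, a i * φ i U) +
                        l2 (fun U => ∑ i, a i * G i U - ∑ i, a i * φ i U) (fun U => ∑ i, a i * G i U - ∑ i, a i * φ i U)) ∧
                qform su2Rep β (fun U => ∑ i, a i * G i U - ∑ i, a i * φ i U) (fun U => ∑ i, a i * G i U - ∑ i, a i * φ i U) ≤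
                    (1 - gap) * (N * levelValue su2Rep 1 ((L : ℝ) ^ 3 * β) 1) *
                      l2 (fun U => ∑ i, a i * G i U - ∑ i, a i * φ i U) (fun U => ∑ i, a i * G i U - ∑ i, a i * φ i U) ∧
                qform su2Rep β (fun U => ∑ i, a i * φ i U) (fun U => ∑ i, a i * G i U - ∑ i, a i * φ i U) ^ 2 ≤
                    C * bareLambda ((L : ℝ) ^ 3 * β) ^ 2 * (N * levelValue su2Rep 1 ((L : ℝ) ^ 3 * β) 1) ^ 2 *
                      (l2 (fun U => ∑ i, a i * φ i U) (fun U => ∑ i, a i * φ i U) *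
                        l2 (fun U => ∑ i, a i * G i U - ∑ i, a i * φ i U) (fun U => ∑ i, a i * G i U - ∑ i, a i * φ i U)) ∧
                qform su2Rep β (fun U => ∑ i, a i * φ i U) (fun U => ∑ i, a i * φ i U) ≤
                    Real.exp (C * bareLambda ((L : ℝ) ^ 3 * β) ^ 2) * N *
                        qform su2Rep ((L : ℝ) ^ 3 * β) (fun U => ∑ i, a i * g i U) (fun U => ∑ i, a i * g i U) +
                      C * bareLambda ((L : ℝ) ^ 3 * β) ^ 2 * (N * levelValue su2Rep 1 ((L : ℝ) ^ 3 * β) 1) *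
                        l2 (fun U => ∑ i, a i * φ i U) (fun U => ∑ i, a i * φ i U) ∧
                l2 (fun U => ∑ i, a i * g i U) (fun U => ∑ i, a i * g i U) ≤
                    Real.exp (C * bareLambda ((L : ℝ) ^ 3 * β) ^ 2) * l2 (fun U => ∑ i, a i * φ i U) (fun U => ∑ i, a i * φ i U)

/-- stub (the ONLY one; HARDEST; = `Cruxes.FixedLatticeLaw.Rate.stub_boRate` of crux 23943 — one pooled obligation, the rate twin of route RED lane A's
C4-CORE): the adiabatic split (P1)(P3)(P4)(P5)(P6) + the floor with rate, at level one, inner scale `β^{−1/40}`, on every lattice of size `L ≥ 2`. -/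
theorem stub_boRate : BORateAll := by
  sorry

/-- ★ The crux BY NAME from exactly the one declared stub, through the kernel-checked composition landed in the tree as
`FlatTubeReduction.nearFlatRatioLaw_of_boRate` (p626045). -/
theorem NearFlatRatioLaw_holds_of_stubs : Summit.QuantumFields.YangMills.Theses.FlatTubeReduction.NearFlatRatioLaw :=
  nearFlatRatioLaw_of_boRate stub_boRate

end Summit.QuantumFields.YangMills.Cruxes.NearFlatRatioLaw.Borate

end
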